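import Summits.AtomisticToContinuum.HydrodynamicLimit.Theorems.AntiMazurCoboundariesCellForecastPressureDecayKinematicAssemblyPathwise
import Summits.AtomisticToContinuum.HydrodynamicLimit.Theorems.AntiMazurCoboundariesCellForecastPressureDecayKinematicAssemblyStatics
import Summits.AtomisticToContinuum.HydrodynamicLimit.Theorems.AntiMazurCoboundariesCellForecastPressureDecayKinematicAssemblyNoCollision
import Summits.AtomisticToContinuum.HydrodynamicLimit.Theorems.AntiMazurCoboundariesCellForecastPressureDecayClusterTailCharging
import Summits.AtomisticToContinuum.HydrodynamicLimit.Theorems.AntiMazurCoboundariesCellForecastPressureDecayClusterTailInsertion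
import Summits.AtomisticToContinuum.HydrodynamicLimit.Theorems.AntiMazurCoboundariesCellForecastPressureDecayClusterTailAssemblyA
import Literature.Analysis.FluidPDE.HardSphereCollisionTimeMeasurable
import HarnessLib

/-!
# S2d′ · kinematic assembly from the cluster tail, piece 3: the counting functions are measurable, and the dynamical
# error integrates (registered sub-goal `stub_kinematicAssemblyOfTail_error` of stub `stub_kinematicAssemblyOfTail`,
# crux line `enskog-compensator-martingale`, crux `CellForecastPressureDecay`, stmt-AtomisticToContinuum-13915)

The DYNAMICAL error of the equal-time Enskog kinematics `KinematicRates σ` (stub S2d′): against any velocity functional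
`|F| ≤ 1`, the cell-law expectation of `∑ᵢ [w(vᵢ(Δ)) − w(vᵢ)] − ½ ∑_{i≠j} φ_{vᵢ,vⱼ}(xᵢ − xⱼ)` is bounded by `2b` times the
sum of the two cluster-tail expectations (the bounds `(a)`, `(b)` of `ClusterTail σ`, taken as hypotheses with values
`K₁, K₂`): the pathwise bookkeeping `stub_kinematicAssemblyOfTail_pathwise` holds on the good set, which carries the cell
law (`ae_mem_good_cellLaw`), the integrand is bounded and measurable (`measurable_flow`), and Tonelli splits the upper
bound because the counting functions are a.e.-measurable (§ 1–2): the events `IsFreeIn`, `IsIsolatedPair` quantify over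
the uncountably many times of the slab, but on the good set the collisions of a sphere in `(0, Δ]` are enumerated by the
measurable collision times `Φ.nthCollisionTimeOf i m` (`HardSphereCollisionTimeMeasurable`, `HardSphereWindowEnumeration`)
and the configurations at these times are measurable in the datum, which reduces both events to countable Boolean
combinations of measurable ones.

References: Gallagher–Saint-Raymond–Texier 2013, §4.1–4.2; Cercignani–Illner–Pulvirenti 1994, §4.2–4.3, App. 4.A.
-/

noncomputable section

open MeasureTheory ProbabilityTheory Set Filter Topology
open scoped ENNReal BigOperators InnerProductSpace
open Literature.Analysis.FluidPDE Literature.MathematicalPhysics.KineticTheory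
open Summit.AtomisticToContinuum.HydrodynamicLimit.Theorems.CellForecastPressureDecay (isProbabilityMeasure_cellLaw)

namespace Summit.AtomisticToContinuum.HydrodynamicLimit.Theorems.EnskogCompensator

/-! ## Free spheres and isolated pairs through the enumerated collisions -/

section Enumerated

variable {σ : ℝ} {n : ℕ} (Ψ : Flows σ) (Δ : ℝ)

/-- On the good set, `i` is free in the slab iff it has no collision time in `(0, Δ]`. [folklore] -/
theorem isFreeIn_iff_ncard {z : Cell n} (hz : z ∈ (Ψ n).good) (i : Fin n) :
    IsFreeIn Ψ Δ z i ↔ ¬ 0 < (collisionTimesOf (Euclidean.geometry (Fin 3)) σ (fun s => (Ψ n).flow s z) i ∩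
      Set.Ioc 0 Δ).ncard := by
  have hfin := ((Ψ n).isTrajectory z hz).finite_collisionTimesOf_inter_Ioc i 0 Δ
  rw [Nat.pos_iff_ne_zero, not_not, Set.ncard_eq_zero hfin, Set.eq_empty_iff_forall_notMem]
  constructor
  · rintro h s ⟨hs, hsI⟩
    exact h s hsI hs
  · intro h s hsI hs
    exact h s ⟨hs, hsI⟩

/-- On the good set, "every collision of `i` in the slab is with `j`" iff this holds at the enumerated collision
times of `i` in `(0, Δ]`. [folklore] -/
theorem forall_collide_iff_enum {z : Cell n} (hz : z ∈ (Ψ n).good) (i j : Fin n) :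
    (∀ s ∈ Set.Ioc 0 Δ, ∀ k, Collide (Euclidean.geometry (Fin 3)) σ ((Ψ n).flow s z) i k → k = j) ↔
      ∀ m : ℕ, m < (collisionTimesOf (Euclidean.geometry (Fin 3)) σ (fun s => (Ψ n).flow s z) i ∩
          Set.Ioc 0 Δ).ncard →
        ∀ k, Collide (Euclidean.geometry (Fin 3)) σ ((Ψ n).flow ((Ψ n).nthCollisionTimeOf i m z) z) i k → k = j := by
  constructor
  · intro h m hm k hk
    exact h _ ((Ψ n).nthCollisionTimeOf_mem_window hz i hm).2 k hk
  · intro h s hs k hk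
    have hsmem : s ∈ collisionTimesOf (Euclidean.geometry (Fin 3)) σ (fun s => (Ψ n).flow s z) i ∩ Set.Ioc 0 Δ :=
      ⟨⟨k, hk⟩, hs⟩
    obtain ⟨m, hm, hms⟩ := (Ψ n).exists_lt_ncard_nthCollisionTimeOf_eq hz i hsmem
    refine h m hm k ?_
    rw [hms]
    exact hk

/-- The window count event "`i` has more than `m` collisions in `(0, Δ]`" is measurable on the good set. [folklore] -/
theorem measurable_lt_ncard (i : Fin n) (m : ℕ) :
    Measurable fun z : (Ψ n).good => m < (collisionTimesOf (Euclidean.geometry (Fin 3)) σ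
      (fun s => (Ψ n).flow s (z : Cell n)) i ∩ Set.Ioc 0 Δ).ncard :=
  measurableSet_setOf.1 ((Ψ n).measurableSet_lt_ncard_collisionTimesOf_window continuous_norm_euclidean_sepVec
    Euclidean.measurable_geometry_sepVec i Δ m)

/-- The event "`i` collides with `k` at its `m`-th collision" is measurable on the good set. [folklore] -/
theorem measurable_collide_nth (i k : Fin n) (m : ℕ) :
    Measurable fun z : (Ψ n).good =>
      Collide (Euclidean.geometry (Fin 3)) σ ((Ψ n).flow ((Ψ n).nthCollisionTimeOf i m z) z) i k :=
  measurableSet_setOf.1 ((measurableSet_collide σ n i k).preimage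
    ((Ψ n).measurable_flow_nthCollisionTimeOf_comp_subtype continuous_euclidean_translate
      continuous_norm_euclidean_sepVec Euclidean.measurable_geometry_sepVec i m))

/-- **`IsFreeIn` is a measurable event on the good set.** [folklore] -/
theorem measurable_isFreeIn (i : Fin n) : Measurable fun z : (Ψ n).good => IsFreeIn Ψ Δ (z : Cell n) i := by
  have h : (fun z : (Ψ n).good => IsFreeIn Ψ Δ (z : Cell n) i) = fun z : (Ψ n).good =>
      ¬ 0 < (collisionTimesOf (Euclidean.geometry (Fin 3)) σ (fun s => (Ψ n).flow s (z : Cell n)) i ∩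
        Set.Ioc 0 Δ).ncard := by
    funext z
    exact propext (isFreeIn_iff_ncard Ψ Δ z.2 i)
  rw [h]
  exact (measurable_lt_ncard Ψ Δ i 0).not

/-- **`IsIsolatedPair` is a measurable event on the good set.** [folklore] -/
theorem measurable_isIsolatedPair (i j : Fin n) :
    Measurable fun z : (Ψ n).good => IsIsolatedPair Ψ Δ (z : Cell n) i j := by
  have hQ : ∀ a c : Fin n, Measurable fun z : (Ψ n).good =>
      ∀ s ∈ Set.Ioc 0 Δ, ∀ k, Collide (Euclidean.geometry (Fin 3)) σ ((Ψ n).flow s (z : Cell n)) a k → k = c := by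
    intro a c
    have h : (fun z : (Ψ n).good =>
        ∀ s ∈ Set.Ioc 0 Δ, ∀ k, Collide (Euclidean.geometry (Fin 3)) σ ((Ψ n).flow s (z : Cell n)) a k → k = c) =
        fun z : (Ψ n).good => ∀ m : ℕ, m < (collisionTimesOf (Euclidean.geometry (Fin 3)) σ
          (fun s => (Ψ n).flow s (z : Cell n)) a ∩ Set.Ioc 0 Δ).ncard →
            ∀ k, Collide (Euclidean.geometry (Fin 3)) σ
              ((Ψ n).flow ((Ψ n).nthCollisionTimeOf a m (z : Cell n)) (z : Cell n)) a k → k = c := by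
      funext z
      exact propext (forall_collide_iff_enum Ψ Δ z.2 a c)
    rw [h]
    exact Measurable.forall fun m => (measurable_lt_ncard Ψ Δ a m).imp
      (Measurable.forall fun k => (measurable_collide_nth Ψ a k m).imp measurable_const)
  exact measurable_const.and ((hQ i j).and (hQ j i))

end Enumerated

/-! ## The collision cylinder event and the two counting functions -/

/-- **`InCylinder` is a measurable event** (hitting-time form of the cylinder, `measurableSet_cylRel`). [folklore] -/
theorem measurable_inCylinder {σ : ℝ} (hσ : 0 < σ) (Δ : ℝ) (n : ℕ) (i j : Fin n) :
    Measurable fun z : Cell n => InCylinder σ Δ z i j := by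
  have h : (fun z : Cell n => InCylinder σ Δ z i j) = fun z : Cell n =>
      ((z i).1 - (z j).1, (z i).2 - (z j).2) ∈ {p : V3 × V3 | PairHits σ p.1 p.2 ∧ 0 < pairDisc σ p.1 p.2 ∧
        pairHitTime σ p.1 p.2 ∈ Ioc 0 Δ} := by
    funext z
    exact propext (exists_cylinder_iff_pairHits hσ Δ _ _)
  rw [h]
  refine measurableSet_setOf.1 ((measurableSet_cylRel σ Δ).preimage ?_)
  exact ((measurable_pi_apply i).fst.sub (measurable_pi_apply j).fst).prodMk
    ((measurable_pi_apply i).snd.sub (measurable_pi_apply j).snd)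

/-- A filter count is a sum of indicators (in `ℝ≥0∞`). [folklore] -/
theorem card_filter_cast {ι : Type*} [Fintype ι] (p : ι → Prop) [DecidablePred p] :
    (((Finset.univ : Finset ι).filter p).card : ℝ≥0∞) = ∑ a, (if p a then (1 : ℝ≥0∞) else 0) := by
  rw [Finset.card_filter]
  push_cast
  exact Finset.sum_congr rfl fun a _ => by split_ifs <;> simp

open Classical in
/-- **The first counting function of the cluster tail is measurable on the good set**: the number of spheres that are
neither free nor in an isolated pair of the slab. [folklore] -/
theorem measurable_card_bad {σ : ℝ} (Ψ : Flows σ) (Δ : ℝ) (n : ℕ) :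
    Measurable fun z : (Ψ n).good => (((Finset.univ.filter fun i : Fin n =>
      ¬ (IsFreeIn Ψ Δ (z : Cell n) i ∨ ∃ j, IsIsolatedPair Ψ Δ (z : Cell n) i j)).card : ℕ) : ℝ≥0∞) := by
  simp only [card_filter_cast]
  refine Finset.measurable_sum _ fun i _ => Measurable.ite ?_ measurable_const measurable_const
  exact measurableSet_setOf.2 (((measurable_isFreeIn Ψ Δ i).or
    (Measurable.exists fun j => measurable_isIsolatedPair Ψ Δ i j)).not)

open Classical in
/-- **The second counting function of the cluster tail is measurable on the good set**: the number of ordered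
non-isolated pairs whose initial data lie in the collision cylinder of the slab. [folklore] -/
theorem measurable_card_cyl {σ : ℝ} (hσ : 0 < σ) (Ψ : Flows σ) (Δ : ℝ) (n : ℕ) :
    Measurable fun z : (Ψ n).good => (((Finset.univ.filter fun p : Fin n × Fin n =>
      p.1 ≠ p.2 ∧ InCylinder σ Δ (z : Cell n) p.1 p.2 ∧ ¬ IsIsolatedPair Ψ Δ (z : Cell n) p.1 p.2).card : ℕ) :
        ℝ≥0∞) := by
  simp only [card_filter_cast]
  refine Finset.measurable_sum _ fun p _ => Measurable.ite ?_ measurable_const measurable_const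
  exact measurableSet_setOf.2 (measurable_const.and
    (((measurable_inCylinder hσ Δ n p.1 p.2).comp measurable_subtype_coe).and
      (measurable_isIsolatedPair Ψ Δ p.1 p.2).not))

/-- The cell law is carried by the good set of the whole-cell flow. [folklore] -/
theorem cellLaw_compl_good (σ L : ℝ) (n : ℕ) (Ψ : Flows σ) : cellLaw σ L n Ψ (Ψ n).goodᶜ = 0 := by
  have hac : cellLaw σ L n Ψ ≪ liouville (Euclidean.geometry (Fin 3)) n σ := by
    rw [cellLaw, particleLaw_eq]
    exact withDensity_absolutelyContinuous _ _
  exact hac (Ψ n).measure_compl_good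

open Classical in
/-- **The two counting functions of `ClusterTail σ` are a.e.-measurable under the canonical cell law** — spheres
neither free nor in an isolated pair of the slab, and ordered non-isolated pairs with initial data in the collision
cylinder (they are measurable on the good set of the whole-cell flow, which carries the cell law). [cite: GST2013, §4.1] -/
theorem aemeasurable_clusterCounts : ∀ (σ L Δ : ℝ) (n : ℕ) (Ψ : Flows σ), 0 < σ →
    AEMeasurable (fun z : Cell n => (((Finset.univ.filter fun i : Fin n =>
      ¬ (IsFreeIn Ψ Δ z i ∨ ∃ j, IsIsolatedPair Ψ Δ z i j)).card : ℕ) : ℝ≥0∞)) (cellLaw σ L n Ψ) ∧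
    AEMeasurable (fun z : Cell n => (((Finset.univ.filter fun p : Fin n × Fin n =>
      p.1 ≠ p.2 ∧ InCylinder σ Δ z p.1 p.2 ∧ ¬ IsIsolatedPair Ψ Δ z p.1 p.2).card : ℕ) : ℝ≥0∞)) (cellLaw σ L n Ψ) :=
  fun σ L Δ n Ψ hσ =>
    ⟨(Ψ n).aemeasurable_of_measurable_comp_subtype (measurable_card_bad Ψ Δ n) (cellLaw_compl_good σ L n Ψ),
      (Ψ n).aemeasurable_of_measurable_comp_subtype (measurable_card_cyl hσ Ψ Δ n) (cellLaw_compl_good σ L n Ψ)⟩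


/-! ## Measurability and boundedness of the slab increment and of the static pair sum -/

section Integrand

variable {σ : ℝ} {n : ℕ}

/-- The velocity of sphere `i` at time `t` along the whole-cell flow is a measurable function of the datum. [folklore] -/
theorem measurable_flow_vel (Ψ : Flows σ) (t : ℝ) (i : Fin n) :
    Measurable fun z : Cell n => ((Ψ n).flow t z i).2 :=
  ((measurable_pi_apply i).comp ((Ψ n).measurable_flow t)).snd

/-- The slab increment `∑ᵢ [w(vᵢ(Δ)) − w(vᵢ)]` is measurable in the datum. [folklore] -/
theorem measurable_increment (Ψ : Flows σ) (Δ : ℝ) {w : V3 → ℝ} (hw : Measurable w) :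
    Measurable fun z : Cell n => ∑ i, (w ((Ψ n).flow Δ z i).2 - w (z i).2) :=
  Finset.measurable_sum _ fun i _ =>
    (hw.comp (measurable_flow_vel Ψ Δ i)).sub (hw.comp (measurable_pi_apply i).snd)

/-- The slab increment is bounded by `2bn`. [folklore] -/
theorem abs_increment_le (Ψ : Flows σ) (Δ : ℝ) {w : V3 → ℝ} {b : ℝ} (hwb : ∀ v, |w v| ≤ b) (z : Cell n) :
    |∑ i, (w ((Ψ n).flow Δ z i).2 - w (z i).2)| ≤ 2 * b * n := by
  calc |∑ i, (w ((Ψ n).flow Δ z i).2 - w (z i).2)| ≤ ∑ i, |w ((Ψ n).flow Δ z i).2 - w (z i).2| :=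
        Finset.abs_sum_le_sum_abs _ _
    _ ≤ ∑ _i : Fin n, 2 * b := Finset.sum_le_sum fun i _ => by
        have h1 := hwb ((Ψ n).flow Δ z i).2
        have h2 := hwb (z i).2
        linarith [abs_sub (w ((Ψ n).flow Δ z i).2) (w (z i).2)]
    _ = 2 * b * n := by rw [Finset.sum_const, Finset.card_univ, Fintype.card_fin, nsmul_eq_mul, mul_comm]

end Integrand

/-! ## The registered sub-goal: the dynamical error of the kinematic assembly -/

open Classical in
/-- **Registered sub-goal `stub_kinematicAssemblyOfTail_error`** (piece of stub `stub_kinematicAssemblyOfTail`, S2d′, of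
the line `enskog-compensator-martingale`): **the dynamical error of the equal-time kinematics.** Under the canonical cell
law (`0 < σ ≤ 3/16`, `L ≥ 1`, `n ≤ 2L³`), for a slab `Δ > 0`, a measurable `|w| ≤ b`, a jointly measurable family of pair
functionals `φ_{v,u}` with the on/off-cylinder clauses of `stub_kinematicAssembly_mainTerm` (`|φ| ≤ 4b`) and a
measurable velocity functional `|F| ≤ 1`: if the two counting functions of `ClusterTail σ` have expectations `≤ K₁`,
`≤ K₂`, then `F(v) · (∑ᵢ [w(vᵢ(Δ)) − w(vᵢ)] − ½ ∑_{i≠j} φ_{vᵢ,vⱼ}(xᵢ − xⱼ))` is integrable and its expectation is at most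
`2b K₁ + 2b K₂` in absolute value (pathwise bookkeeping on the good set, Tonelli). [cite: CIP1994, §4.3] -/
theorem stub_kinematicAssemblyOfTail_error : ∀ (σ L : ℝ) (n : ℕ) (Ψ : Flows σ) (Δ b K₁ K₂ : ℝ) (w : V3 → ℝ)
    (φ : V3 → V3 → V3 → ℝ) (F : (Fin n → V3) → ℝ), 0 < σ → σ ≤ 3 / 16 → 1 ≤ L → (n : ℝ) ≤ 2 * L ^ 3 → 0 < Δ →
    Measurable w → (∀ v, |w v| ≤ b) → Measurable (fun p : V3 × V3 × V3 => φ p.1 p.2.1 p.2.2) →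
    (∀ v u q, |φ v u q| ≤ 4 * b) →
    (∀ (v u : V3) (ω : Metric.sphere (0 : V3) 1) (t : ℝ), t ∈ Set.Ioc 0 Δ → inner ℝ (ω : V3) (v - u) < 0 →
      φ v u (σ • (ω : V3) - t • (v - u)) =
        w (reflectVel (σ • (ω : V3)) (v, u)).1 + w (reflectVel (σ • (ω : V3)) (v, u)).2 - w v - w u) →
    (∀ (v u q : V3), (¬ ∃ (ω : Metric.sphere (0 : V3) 1) (t : ℝ), t ∈ Set.Ioc 0 Δ ∧
      inner ℝ (ω : V3) (v - u) < 0 ∧ q = σ • (ω : V3) - t • (v - u)) → φ v u q = 0) →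
    Measurable F → (∀ x, |F x| ≤ 1) → 0 ≤ K₁ → 0 ≤ K₂ →
    ∫⁻ z, ((Finset.univ.filter fun i : Fin n =>
        ¬ (IsFreeIn Ψ Δ z i ∨ ∃ j, IsIsolatedPair Ψ Δ z i j)).card : ℝ≥0∞) ∂(cellLaw σ L n Ψ) ≤ ENNReal.ofReal K₁ →
    ∫⁻ z, ((Finset.univ.filter fun p : Fin n × Fin n =>
        p.1 ≠ p.2 ∧ InCylinder σ Δ z p.1 p.2 ∧ ¬ IsIsolatedPair Ψ Δ z p.1 p.2).card : ℝ≥0∞) ∂(cellLaw σ L n Ψ) ≤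
      ENNReal.ofReal K₂ →
      Integrable (fun z : Cell n => F (fun i => (z i).2) * ((∑ i, (w ((Ψ n).flow Δ z i).2 - w (z i).2)) -
        (1 / 2) * ∑ i, ∑ j, (if i = j then 0 else φ (z i).2 (z j).2 ((z i).1 - (z j).1)))) (cellLaw σ L n Ψ) ∧
      |∫ z, F (fun i => (z i).2) * ((∑ i, (w ((Ψ n).flow Δ z i).2 - w (z i).2)) -
          (1 / 2) * ∑ i, ∑ j, (if i = j then 0 else φ (z i).2 (z j).2 ((z i).1 - (z j).1))) ∂(cellLaw σ L n Ψ)| ≤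
        2 * b * K₁ + 2 * b * K₂ := by
  intro σ L n Ψ Δ b K₁ K₂ w φ F hσ hσ' hL hn hΔ hw hwb hφm hφb hon hoff hF hFb hK₁ hK₂ hbad hcyl
  haveI : IsProbabilityMeasure (cellLaw σ L n Ψ) := isProbabilityMeasure_cellLaw hσ' hL hn (Ψ n)
  have hb : 0 ≤ b := (abs_nonneg _).trans (hwb 0)
  have hb2 : 0 ≤ 2 * b := by positivity
  set D : Cell n → ℝ := fun z => (∑ i, (w ((Ψ n).flow Δ z i).2 - w (z i).2)) -
    (1 / 2) * ∑ i, ∑ j, (if i = j then 0 else φ (z i).2 (z j).2 ((z i).1 - (z j).1)) with hD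
  set g : Cell n → ℝ := fun z => F (fun i => (z i).2) * D z with hg
  have hvel : Measurable fun z : Cell n => fun i => (z i).2 := measurable_pi_lambda _ fun i => (measurable_pi_apply i).snd
  have hDm : Measurable D :=
    (measurable_increment Ψ Δ hw).sub (measurable_const.mul (measurable_pairSum hφm))
  have hgm : Measurable g := (hF.comp hvel).mul hDm
  have hDb : ∀ z, |D z| ≤ 2 * b * n + 2 * b * (n * n) := fun z => by
    have h1 := abs_increment_le Ψ Δ hwb z
    have h2 := abs_pairSum_le (n := n) hφb z
    calc |D z| ≤ |∑ i, (w ((Ψ n).flow Δ z i).2 - w (z i).2)| +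
          |(1 / 2) * ∑ i, ∑ j, (if i = j then 0 else φ (z i).2 (z j).2 ((z i).1 - (z j).1))| := abs_sub _ _
      _ ≤ 2 * b * n + 2 * b * (n * n) := by
          rw [abs_mul, abs_of_pos (by norm_num : (0 : ℝ) < 1 / 2)]
          linarith
  have hgD : ∀ z, |g z| ≤ |D z| := fun z => by
    rw [hg, abs_mul]
    exact (mul_le_mul_of_nonneg_right (hFb _) (abs_nonneg _)).trans (one_mul _).le
  have hgi : Integrable g (cellLaw σ L n Ψ) :=
    Integrable.of_bound hgm.aestronglyMeasurable (2 * b * n + 2 * b * (n * n))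
      (ae_of_all _ fun z => by rw [Real.norm_eq_abs]; exact (hgD z).trans (hDb z))
  refine ⟨hgi, ?_⟩
  -- the pathwise bookkeeping, almost everywhere
  have hpath : ∀ᵐ z ∂cellLaw σ L n Ψ, ‖g z‖ₑ ≤
      ENNReal.ofReal (2 * b) * ((Finset.univ.filter fun i : Fin n =>
        ¬ (IsFreeIn Ψ Δ z i ∨ ∃ j, IsIsolatedPair Ψ Δ z i j)).card : ℝ≥0∞) +
      ENNReal.ofReal (2 * b) * ((Finset.univ.filter fun p : Fin n × Fin n =>
        p.1 ≠ p.2 ∧ InCylinder σ Δ z p.1 p.2 ∧ ¬ IsIsolatedPair Ψ Δ z p.1 p.2).card : ℝ≥0∞) := by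
    filter_upwards [ae_mem_good_cellLaw σ L n Ψ] with z hz
    have h := stub_kinematicAssemblyOfTail_pathwise σ n Ψ z hz hσ Δ b w φ hΔ hwb hφb hon hoff
    have h1 := (hgD z).trans h
    rw [Real.enorm_eq_ofReal_abs]
    refine (ENNReal.ofReal_le_ofReal h1).trans_eq ?_
    rw [ENNReal.ofReal_add (by positivity) (by positivity), ENNReal.ofReal_mul hb2, ENNReal.ofReal_mul hb2,
      ENNReal.ofReal_natCast, ENNReal.ofReal_natCast]
  obtain ⟨hmb, hmc⟩ := aemeasurable_clusterCounts σ L Δ n Ψ hσ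
  have hlin : ∫⁻ z, ‖g z‖ₑ ∂cellLaw σ L n Ψ ≤ ENNReal.ofReal (2 * b * K₁ + 2 * b * K₂) := by
    refine (lintegral_mono_ae hpath).trans ?_
    rw [lintegral_add_left' (hmb.const_mul _), lintegral_const_mul'' _ hmb, lintegral_const_mul'' _ hmc,
      ENNReal.ofReal_add (by positivity) (by positivity), ENNReal.ofReal_mul hb2, ENNReal.ofReal_mul hb2]
    gcongr
  calc |∫ z, g z ∂cellLaw σ L n Ψ| ≤ ∫ z, |g z| ∂cellLaw σ L n Ψ := abs_integral_le_integral_abs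
    _ = ∫ z, ‖g z‖ ∂cellLaw σ L n Ψ := by simp only [Real.norm_eq_abs]
    _ = (∫⁻ z, ‖g z‖ₑ ∂cellLaw σ L n Ψ).toReal := integral_norm_eq_lintegral_enorm hgm.aestronglyMeasurable
    _ ≤ 2 * b * K₁ + 2 * b * K₂ := ENNReal.toReal_le_of_le_ofReal (by positivity) hlin

end Summit.AtomisticToContinuum.HydrodynamicLimit.Theorems.EnskogCompensator

end
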